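import Literature.MathematicalPhysics.QuantumFieldTheory.Balaban1983to89.Node00.CriticalOfRecord
import Literature.MathematicalPhysics.QuantumFieldTheory.Balaban1983to89.Node00.Record12MinimiserSelection
import Summits.QuantumFields.YangMills.Theorems.BalabanUVNodesN21AveragedDatumRegularity

/-!
# BalabanUVNodes ∕ N07 ([Balaban1985Variational] Theorem 1 (8) p. 279) — THE DIRECT METHOD AT NODE 00's OBJECTS:
# the Wilson action ATTAINS ITS MINIMUM on every CLOSED small-field class of the constraint surface `𝔅_k(V) = {U : Ū^k = V}` of the
# averaging of record, and the existence clause (8) ∕ ₈a's solvability `UkExists` are RE-POINTED onto ONE displayed ∀-sentence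
# («minimisers over the closed class are interior»)

Track A of `YM-PLAN.md` (cell `pub-ymgap`, HUMAN RULING D-0062), DAG node **N07** = [Balaban1985Variational] T. Bałaban, *The variational problem
and background fields in renormalization group method for lattice gauge theories*, Commun. Math. Phys. **102** (1985) 277–309, Theorem 1 p. 279
with the spaces (2), (3), (6), (8) p. 278 and the functional (5); seat `pub-ymgap-dag-n07-e` (generation 5; director-ym R141 (C) row s3 continuation,
module 11; `--supports stmt-QuantumFields-19903 --as helper`).  THEOREMS ONLY (0 `def`, 0 `sorry`, standard axioms); nothing imported is modified.

WHY THIS FILE.  After modules 1–10 of this seat and node00-def-B11's pins, the N07 node sentence at the fully-pinned residual layer displays ONLY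
printed statements, and its Theorem-1 slot READS OBJECT SENTENCES (`…N07AtRecordFullyPinned` §1, §3): the existence clause (8) reads
`B11Thm1.Exists8 (varProblemT F N K k R) B₃ ε₁ V` ⇔ «a minimiser of the Wilson action (5) over `𝔘_k(B₃ε₁) ∩ 𝔅_k(V)` EXISTS and lies in that
space» (n07-a's `B11Thm1CarrierT.exists8_iff`), and ₈a's solvability letter of [I] (1.1) reads `Node00.UkExists F N K k ε V` ⇔ «a minimiser over
`bgReg(ε) ∩ 𝔅_k(V)` exists».  Print reaches (8) through Propositions 4–7 (a contraction for (111)) and the second-order argument (142) p. 299 — a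
STRICT LOCAL minimum (cell DIVERGENCE D-B11-2 ∕ GAPS G-B11-E5R, typed in `B11GlobalMin`).  This module proves, at NODE 00's objects and for
Bałaban's averaging OF RECORD `Node00.avOfRecord = blockAvg expMeanLogSU`, the half of (8) that the DIRECT METHOD of the calculus of variations
gives for free, and isolates the other half as one ∀-sentence:

* §1 TOPOLOGY of the configuration spaces `SU(N)^{bonds}` of the tori of record: compact (tree `QuantumLattice.GaugeGroups`: `SU(N)` compact),
  the Wilson action continuous, the non-strict plaquette classes `{U | ∀p, |U(∂p) − 1| ≤ a}` CLOSED, hence `closure 𝔘-class(e) ⊆ class(α₀)` for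
  `e < α₀` (both for ₈a's plaquette class `bgReg` and for [B11] (2)'s full class `InUkClassB11`, via n01-b's `InUkClassB11.mem_bgReg`).
* §2 ★ CONTINUITY OF THE AVERAGING OF RECORD ON SMALL FIELDS.  The total (0.4) map `avgFun expMeanLogSU` is NOT continuous (it is `1` off the
  guard — `BlockAveragingExpMeanLogContinuous`, header), but it IS continuous at every configuration whose (0.4) loop variables sit inside the
  guard (K0c's `Node00.continuousOn_avg_loopHol` + `isOpen_small`), hence at every `U` with `PlaqSmall a U`, `(((d+2)L)²/4)·a < δ_N`
  (`LatticeWordStokes.small_of_plaqSmall`); and the `k`-FOLD average `Ū^i = Averaging.iter (avOfRecord F N K) i U`, `i ≤ k`, is continuous at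
  every `U` with `PlaqSmall (α₀η_k²) U` for `α₀` admissible as in [Balaban1985Averaging] (53) (`C₀(d)α₀ ≤ ⅓`, `2α₀ ≤ c′₂`) — EVERY intermediate
  level stays in the guard by n21-c's PROVED Proposition 2 (`plaqSmall_iter_avOfRecord_level`, p469485).  So `Ū^k` is continuous ON `bgReg(α₀)`.
* §3 ★★ THE DIRECT METHOD (`exists_isBackground_of_isClosed`): for every CLOSED class `reg ⊆ bgReg(α₀)` and every datum `V` whose fibre
  `reg ∩ 𝔅_k(V)` is non-empty, the Wilson action has a minimiser over `reg ∩ 𝔅_k(V)`: `∃ U₀, IsBackground (avOfRecord F N K) reg k V U₀`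
  (the fibre is closed by §2, compact by §1, the action continuous: `IsCompact.exists_isMinOn`).  Instances: the closures of ₈a's class
  `bgReg(e)` and of [B11] (2)'s class `𝔘_k(e)`, `e < α₀`.
* WHAT THIS RE-POINTS is the companion module `…N07DirectMethodInduction` (same seat, filed with this one): ₈a's `UkExists` and N07's (8) at the
  socket ⟸ ONE displayed ∀-sentence «closed-class minimisers are interior» (the a-priori species of Prop. 7 (ii) ∕ Sect. F); interior closed-class
  minimisers are CRITICAL; a second located door for D-B11-2 (global minimality ⟸ print's unique critical orbit + interiority); print's induction on
  `k` in the closed-class currency (level `1` outright by Sect. A's `V₀`; level `k + 1` from Theorem 1 at level `k`).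

HONEST FRAMING.  Kernel theorems about the tree's own objects (compactness, continuity, the extreme-value theorem); the direct method is NOT print's
route to (8); NOTHING of [Balaban1985Variational] is asserted or proved — what stays DISPLAYED is exactly the interiority ∀-sentence (an L^∞ a-priori
estimate on minimisers: the content of Prop. 7 (ii) ∕ Sect. F), print's uniqueness of the critical orbit, and the non-emptiness of the fibre; N07 is
NOT discharged; COUNT-NEUTRAL (5∕27 unmoved); one finite four-torus programme at fixed `ε = L^{−K}` — NOT the continuum limit, NOT ℝ⁴, NOT infinite
volume, NOT OS, NOT a mass gap, NOT the Clay problem.  No `instance` is declared (local `haveI` only), no notation, 0 kit.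
-/

noncomputable section

namespace Summit.QuantumFields.YangMills.BalabanUVNodes.N07DirectMethod

open Set Filter Topology
open Literature.MathematicalPhysics.QuantumFieldTheory.Balaban1983to89
open Literature.MathematicalPhysics.QuantumFieldTheory.Balaban1983to89.T4Continuum (T4Family)
open Literature.MathematicalPhysics.QuantumFieldTheory.Balaban1983to89.Node00
open Literature.MathematicalPhysics.QuantumFieldTheory.Balaban1983to89.BlockAveraging (blockAvg avgFun corr loopHol Small continuous_axialAvg)
open Literature.MathematicalPhysics.QuantumFieldTheory.Balaban1983to89.ExpMeanLog (expMeanLogSU deltaSU deltaSU_pos)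
open Summit.QuantumFields.YangMills.Theorems.N21AveragedDatumRegularity (plaqSmall_iter_avOfRecord_level)
open scoped Matrix.Norms.L2Operator

/-! ## §1 Topology of the configuration spaces `SU(N)^{bonds}` of record -/

section Topology

variable {N : ℕ} [NeZero N] {P : Params} {j : ℕ}

/-- `|· − 1|` (operator norm) is continuous on `SU(N)` (private copy of K0c's ∕ `B12ContinuousTransportInvarianceOn.continuous_dist1_SU`, kept private
to avoid importing those chains). [folklore] -/
private theorem continuous_dist1_SU : Continuous (dist1 : SU N → ℝ) :=
  UnitaryModel.continuous_opDist1.comp (Literature.MathematicalPhysics.QuantumLattice.continuous_fundamentalRep (Fin N))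

/-- Plaquette variables are continuous in the configuration (private copy of `B12ContinuousTransportInvarianceOn.continuous_plaqHol_SU`). [folklore] -/
private theorem continuous_plaqHol (p : Plaq P j) : Continuous fun U : GaugeField P j (SU N) => GaugeField.plaqHol U p := by
  have hb : ∀ b : PBond P j, Continuous fun U : GaugeField P j (SU N) => U b := fun b => continuous_apply b
  unfold GaugeField.plaqHol
  exact (((hb _).mul (hb _)).mul (hb _).inv).mul (hb _).inv

/-- The plaquette letters `U ↦ |U(∂p) − 1|` of the small-field classes are continuous functions of the configuration.
[cite: Balaban1985Variational, (2) p.278 (bookkeeping)] -/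
theorem continuous_dist1_plaqHol (p : Plaq P j) : Continuous fun U : GaugeField P j (SU N) => dist1 (GaugeField.plaqHol U p) :=
  continuous_dist1_SU.comp (continuous_plaqHol p)

/-- **The Wilson action (5) `A(U) = Σ_p [1 − Re tr U(∂p)]` is a continuous function of the configuration** (product topology of the bond matrices;
twin of `B16Thm1BaseAtRecord11.continuous_wilsonAction4_SU`, re-derived here to keep the import cone). [cite: Balaban1985Variational, (5) p.278] -/
theorem continuous_wilsonAction4 : Continuous (wilsonAction4 : GaugeField P j (SU N) → ℝ) := by
  unfold wilsonAction4 wilsonAction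
  have hre : Continuous (reTr : SU N → ℝ) :=
    UnitaryModel.continuous_nReTr.comp (Literature.MathematicalPhysics.QuantumLattice.continuous_fundamentalRep (Fin N))
  exact continuous_finsetSum _ fun p _ => continuous_const.mul (continuous_const.sub (hre.comp (continuous_plaqHol p)))

omit [NeZero N] in
/-- **`SU(N)^{bonds}` is compact**: every closed set of configurations is compact (`SU(N)` compact — tree `QuantumLattice.GaugeGroups` — and a
finite product of compact spaces is compact; the instance is used locally, none is declared). [folklore] -/
theorem isCompact_of_isClosed_cfg {S : Set (GaugeField P j (SU N))} (hS : IsClosed S) : IsCompact S := by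
  haveI : CompactSpace (GaugeField P j (SU N)) := inferInstanceAs (CompactSpace (PBond P j → SU N))
  exact hS.isCompact

omit [NeZero N] in
/-- Points are closed in `SU(N)^{bonds}` (Hausdorff). [folklore] -/
theorem isClosed_singleton_cfg (V : GaugeField P j (SU N)) : IsClosed ({V} : Set (GaugeField P j (SU N))) := by
  haveI : T2Space (GaugeField P j (SU N)) := inferInstanceAs (T2Space (PBond P j → SU N))
  exact isClosed_singleton

/-- **The NON-STRICT plaquette class `{U | ∀p, |U(∂p) − 1| ≤ a}` is CLOSED** (finitely many non-strict inequalities between continuous functions).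
[cite: Balaban1985Variational, (2) p.278 («(2) are strict upper bounds»: the closed class is its non-strict companion)] -/
theorem isClosed_plaqLe (a : ℝ) : IsClosed {U : GaugeField P j (SU N) | ∀ p : Plaq P j, dist1 (GaugeField.plaqHol U p) ≤ a} := by
  simp only [setOf_forall]
  exact isClosed_iInter fun p => isClosed_le (continuous_dist1_plaqHol p) continuous_const

/-- The closure of the strict plaquette class `{PlaqSmall a}` lies in the non-strict class at the same radius.
[cite: Balaban1985Variational, (2) p.278 (bookkeeping)] -/
theorem closure_plaqSmall_subset_plaqLe (a : ℝ) :
    closure {U : GaugeField P j (SU N) | PlaqSmall a U} ⊆ {U | ∀ p : Plaq P j, dist1 (GaugeField.plaqHol U p) ≤ a} :=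
  closure_minimal (fun _ hU p => (hU p).le) (isClosed_plaqLe a)

/-- … hence in the strict class at any larger radius: `closure {PlaqSmall a} ⊆ {PlaqSmall a′}` for `a < a′`.
[cite: Balaban1985Variational, (2) p.278 (bookkeeping)] -/
theorem closure_plaqSmall_subset_plaqSmall {a a' : ℝ} (h : a < a') :
    closure {U : GaugeField P j (SU N) | PlaqSmall a U} ⊆ {U | PlaqSmall a' U} :=
  fun _ hU p => (closure_plaqSmall_subset_plaqLe a hU p).trans_lt h

end Topology

section Classes

variable {F : T4Family} {N : ℕ} [NeZero N]

/-- **The closure of ₈a's class `bgReg(e) = {U | |U(∂p) − 1| < eη_k² ∀p}` lies in `bgReg(α₀)` for every `e < α₀`.**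
[cite: Balaban1987RG1, (1.2) p.260 (bookkeeping)] -/
theorem closure_bgReg_subset_bgReg (K k : ℕ) {e α₀ : ℝ} (he : e < α₀) :
    closure (bgReg F N K k e) ⊆ bgReg F N K k α₀ :=
  closure_plaqSmall_subset_plaqSmall
    (mul_lt_mul_of_pos_right he (pow_pos (pow_pos (inv_pos.mpr (Nat.cast_pos.mpr (F.P K).L_pos)) k) 2))

/-- **The closure of [B11] (2)'s full class `𝔘_k(e)` (plaquette AND current clauses, `Ω_j = T`) lies in ₈a's plaquette class `bgReg(α₀)`
for every `e < α₀`** (n01-b's `InUkClassB11.mem_bgReg` + §1). [cite: Balaban1985Variational, (2) p.278] -/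
theorem closure_inUkClassB11_subset_bgReg (K k : ℕ) {e α₀ : ℝ} (he : e < α₀) :
    closure {U : GaugeField (F.P K) 0 (SU N) | InUkClassB11 F N K k e U} ⊆ bgReg F N K k α₀ :=
  (closure_mono fun _ hU => InUkClassB11.mem_bgReg hU).trans (closure_bgReg_subset_bgReg K k he)

end Classes

/-! ## §2 The averaging of record is continuous on small fields -/

section Averaging

variable {N : ℕ} [NeZero N] {P : Params} {j : ℕ}

/-- ★ **THE (0.4) BLOCK AVERAGING OF RECORD IS CONTINUOUS AT EVERY CONFIGURATION INSIDE THE GUARD.**  The total map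
`avgFun expMeanLogSU : SU(N)^{bonds_j} → SU(N)^{bonds_{j+1}}` (exp[mean log] of the (0.4) loop variables on the guard `Small`, `1` off it) is
continuous at every `U₀` all of whose loop variables at every coarse bond lie inside the guard: there the guard is an open neighbourhood
(K0c's `isOpen_small`) on which the map is `E(loop variables) · U(c)` with `E` continuous (K0c's `continuousOn_avg_loopHol`).
[cite: Balaban1987RG1, (0.4) p.253] -/
theorem continuousAt_avgFun_expMeanLogSU_of_small {U₀ : GaugeField P j (SU N)}
    (h : ∀ c : PBond P (j + 1), Small (expMeanLogSU (n := Fin N)) U₀ c) :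
    ContinuousAt (avgFun (expMeanLogSU (n := Fin N)) : GaugeField P j (SU N) → GaugeField P (j + 1) (SU N)) U₀ := by
  refine continuousAt_pi.2 fun c => ?_
  have hax : Continuous fun U : GaugeField P j (SU N) => AveragingRT.axialAvg U c := (continuous_apply c).comp continuous_axialAvg
  have hcorr : ContinuousOn (fun U : GaugeField P j (SU N) => corr (expMeanLogSU (n := Fin N)) U c)
      {U | Small (expMeanLogSU (n := Fin N)) U c} := by
    refine (continuousOn_avg_loopHol c).congr fun U hU => ?_
    have hU' : Small (expMeanLogSU (n := Fin N)) U c := hU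
    show corr _ U c = _
    unfold corr
    rw [if_pos hU']
  have hA : ContinuousOn (fun U : GaugeField P j (SU N) => corr (expMeanLogSU (n := Fin N)) U c * AveragingRT.axialAvg U c)
      {U | Small (expMeanLogSU (n := Fin N)) U c} := hcorr.mul hax.continuousOn
  exact hA.continuousAt ((isOpen_small (N := N) c).mem_nhds (h c))

/-- **Continuity of the averaging of record at every small-plaquette configuration**: `PlaqSmall a U₀`, `(((d+2)L)²/4)·a < δ_N` ⇒ the guard holds at
every coarse bond (`LatticeWordStokes.small_of_plaqSmall`) ⇒ `blockAvg expMeanLogSU` is continuous at `U₀`. [cite: Balaban1987RG1, (0.4) p.253] -/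
theorem continuousAt_avg_blockAvg_of_plaqSmall {a : ℝ} (ha : 0 ≤ a) {U₀ : GaugeField P j (SU N)} (hU : PlaqSmall a U₀)
    (ht : ((((P.d + 2) * P.L : ℕ) : ℝ) ^ 2 / 4) * a < deltaSU (Fin N)) :
    ContinuousAt (blockAvg (expMeanLogSU (n := Fin N))).avg U₀ :=
  continuousAt_avgFun_expMeanLogSU_of_small fun c => LatticeWordStokes.small_of_plaqSmall _ ha hU ht c

variable {F : T4Family}

/-- The admissible-radius arithmetic of (53): `2α₀ ≤ c′₂ = 2δ_N/((d+4)L)²` ⇒ `(((d+2)L)²/4)·(2α₀) < δ_N` (via n21-c's `smallness_of_le_c2'`: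
`(((d+4)L)²/4)·(2α₀) ≤ δ_N/2`). [cite: Balaban1985Averaging, Prop. 1 p.26 (bookkeeping)] -/
theorem loopRadius_lt_deltaSU (K : ℕ) {α₀ : ℝ} (hα : 0 < α₀)
    (hα2 : 2 * α₀ ≤ 2 * deltaSU (Fin N) / ((((F.P K).d + 4) * (F.P K).L : ℕ) : ℝ) ^ 2) :
    (((((F.P K).d + 2) * (F.P K).L : ℕ) : ℝ) ^ 2 / 4) * (2 * α₀) < deltaSU (Fin N) := by
  have h1 := BlockAveragingEMLProp2.smallness_of_le_c2' (n := Fin N) (P := F.P K) hα2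
  have hdl : ((((F.P K).d + 2) * (F.P K).L : ℕ) : ℝ) ≤ ((((F.P K).d + 4) * (F.P K).L : ℕ) : ℝ) := by
    exact_mod_cast Nat.mul_le_mul_right _ (by omega)
  have h0 : (0 : ℝ) ≤ ((((F.P K).d + 2) * (F.P K).L : ℕ) : ℝ) := Nat.cast_nonneg _
  have h2 : ((((F.P K).d + 2) * (F.P K).L : ℕ) : ℝ) ^ 2 ≤ ((((F.P K).d + 4) * (F.P K).L : ℕ) : ℝ) ^ 2 := by gcongr
  have hδ := deltaSU_pos (n := Fin N)
  nlinarith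

/-- **EVERY INTERMEDIATE AVERAGE OF A (52)-SMALL CONFIGURATION IS `2α₀`-SMALL**: `PlaqSmall (α₀η_k²) U`, `α₀` admissible as in (53) ⇒
`PlaqSmall (2α₀) (Ū^i)` for all `i ≤ k` (n21-c's `plaqSmall_iter_avOfRecord_level`, the scale factor `(L^iη_k)² ≤ 1` dropped).
[cite: Balaban1985Averaging, (53) p.26] -/
theorem plaqSmall_two_iter_avOfRecord (K k : ℕ) {α₀ : ℝ} (hα : 0 < α₀)
    (hα3 : (143 * (((((F.P K).d + 4 : ℕ) : ℝ)) ^ 2 / 4) ^ 2) * α₀ ≤ 1 / 3)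
    (hα2 : 2 * α₀ ≤ 2 * deltaSU (Fin N) / ((((F.P K).d + 4) * (F.P K).L : ℕ) : ℝ) ^ 2)
    {U : GaugeField (F.P K) 0 (SU N)} (h52 : PlaqSmall (α₀ * (F.P K).eta k ^ 2) U) {i : ℕ} (hi : i ≤ k) :
    PlaqSmall (2 * α₀) (Averaging.iter (avOfRecord F N K) i U) := by
  have h := plaqSmall_iter_avOfRecord_level (N := N) K k hα hα3 hα2 h52 hi
  have hL1 : (1 : ℝ) ≤ ((F.P K).L : ℝ) := by exact_mod_cast (F.P K).L_pos
  have hLk : (0 : ℝ) < ((F.P K).L : ℝ) ^ k := by positivity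
  have hx1 : ((F.P K).L : ℝ) ^ i * (F.P K).eta k ≤ 1 := by
    rw [Params.eta, inv_pow, mul_inv_le_iff₀ hLk, one_mul]
    exact pow_le_pow_right₀ hL1 hi
  have hx0 : 0 ≤ ((F.P K).L : ℝ) ^ i * (F.P K).eta k :=
    (mul_pos (by positivity) (pow_pos (inv_pos.mpr (Nat.cast_pos.mpr (F.P K).L_pos)) k)).le
  have hsq : (((F.P K).L : ℝ) ^ i * (F.P K).eta k) ^ 2 ≤ 1 := pow_le_one₀ hx0 hx1
  intro p
  refine (h p).trans_le ?_
  have : 0 ≤ 2 * α₀ := by positivity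
  nlinarith

/-- **The averaging of record is continuous at every `2α₀`-small configuration** (`α₀ > 0`, `2α₀ ≤ c′₂`), at every level of every torus of the
family. [cite: Balaban1987RG1, (0.4) p.253] -/
theorem continuousAt_avg_avOfRecord_of_plaqSmall_two (K i : ℕ) {α₀ : ℝ} (hα : 0 < α₀)
    (hα2 : 2 * α₀ ≤ 2 * deltaSU (Fin N) / ((((F.P K).d + 4) * (F.P K).L : ℕ) : ℝ) ^ 2)
    {U : GaugeField (F.P K) i (SU N)} (hU : PlaqSmall (2 * α₀) U) :
    ContinuousAt (avOfRecord F N K i).avg U :=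
  continuousAt_avg_blockAvg_of_plaqSmall (by positivity) hU (loopRadius_lt_deltaSU K hα hα2)

/-- ★ **THE `k`-FOLD AVERAGE OF RECORD `Ū^i = Averaging.iter (avOfRecord F N K) i` IS CONTINUOUS AT EVERY (52)-SMALL CONFIGURATION**, `i ≤ k`:
`PlaqSmall (α₀η_k²) U` with `α₀` admissible as in (53) (`0 < α₀`, `C₀(d)α₀ ≤ ⅓`, `2α₀ ≤ c′₂`) — induction on `i`, every intermediate average
staying `2α₀`-small (Proposition 2, PROVED by n21-c) where the one-step averaging is continuous. [cite: Balaban1985Averaging, Prop. 2 (52)–(54) p.26; Balaban1987RG1, (0.4) p.253] -/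
theorem continuousAt_iter_avOfRecord_of_plaqSmall (K k : ℕ) {α₀ : ℝ} (hα : 0 < α₀)
    (hα3 : (143 * (((((F.P K).d + 4 : ℕ) : ℝ)) ^ 2 / 4) ^ 2) * α₀ ≤ 1 / 3)
    (hα2 : 2 * α₀ ≤ 2 * deltaSU (Fin N) / ((((F.P K).d + 4) * (F.P K).L : ℕ) : ℝ) ^ 2)
    {U : GaugeField (F.P K) 0 (SU N)} (h52 : PlaqSmall (α₀ * (F.P K).eta k ^ 2) U) :
    ∀ i : ℕ, i ≤ k → ContinuousAt (Averaging.iter (avOfRecord F N K) i) U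
  | 0, _ => continuousAt_id
  | i + 1, hi => by
    have hi' : i ≤ k := Nat.le_of_succ_le hi
    have hstep : ContinuousAt (avOfRecord F N K i).avg (Averaging.iter (avOfRecord F N K) i U) :=
      continuousAt_avg_avOfRecord_of_plaqSmall_two K i hα hα2 (plaqSmall_two_iter_avOfRecord K k hα hα3 hα2 h52 hi')
    show ContinuousAt ((avOfRecord F N K i).avg ∘ Averaging.iter (avOfRecord F N K) i) U
    exact hstep.comp (continuousAt_iter_avOfRecord_of_plaqSmall K k hα hα3 hα2 h52 i hi')

/-- **`Ū^k` IS CONTINUOUS ON ₈a's CLASS `bgReg(α₀)`** (`α₀` admissible as in (53)). [cite: Balaban1987RG1, (0.21), (1.2) p.256 and p.260] -/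
theorem continuousOn_iter_avOfRecord_bgReg (K k : ℕ) {α₀ : ℝ} (hα : 0 < α₀)
    (hα3 : (143 * (((((F.P K).d + 4 : ℕ) : ℝ)) ^ 2 / 4) ^ 2) * α₀ ≤ 1 / 3)
    (hα2 : 2 * α₀ ≤ 2 * deltaSU (Fin N) / ((((F.P K).d + 4) * (F.P K).L : ℕ) : ℝ) ^ 2) :
    ContinuousOn (Averaging.iter (avOfRecord F N K) k) (bgReg F N K k α₀) :=
  fun U hU => (continuousAt_iter_avOfRecord_of_plaqSmall K k hα hα3 hα2 ((mem_bgReg_iff F N K k α₀ U).1 hU) k le_rfl).continuousWithinAt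

/-- **The constraint surface `𝔅_k(V) = {U : Ū^k = V}` meets every CLOSED class `reg ⊆ bgReg(α₀)` in a CLOSED (hence compact) set.**
[cite: Balaban1985Variational, (3) p.278] -/
theorem isClosed_inter_fibre (K k : ℕ) {α₀ : ℝ} (hα : 0 < α₀)
    (hα3 : (143 * (((((F.P K).d + 4 : ℕ) : ℝ)) ^ 2 / 4) ^ 2) * α₀ ≤ 1 / 3)
    (hα2 : 2 * α₀ ≤ 2 * deltaSU (Fin N) / ((((F.P K).d + 4) * (F.P K).L : ℕ) : ℝ) ^ 2)
    {reg : Set (GaugeField (F.P K) 0 (SU N))} (hreg : IsClosed reg) (hsub : reg ⊆ bgReg F N K k α₀) (V : GaugeField (F.P K) k (SU N)) :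
    IsClosed (reg ∩ Averaging.iter (avOfRecord F N K) k ⁻¹' {V}) :=
  ((continuousOn_iter_avOfRecord_bgReg K k hα hα3 hα2).mono hsub).preimage_isClosed_of_isClosed hreg (isClosed_singleton_cfg V)

end Averaging

/-! ## §3 The direct method: minimisers over closed small-field classes EXIST -/

section DirectMethod

variable {F : T4Family} {N : ℕ} [NeZero N]

/-- ★★ **THE DIRECT METHOD AT NODE 00's OBJECTS.**  On the finest torus of the `K`-th approximation, for EVERY closed class of configurations
`reg ⊆ bgReg(α₀)` (`α₀` admissible as in (53)) and every datum `V` on `T^{(k)}` whose fibre `reg ∩ 𝔅_k(V)` is non-empty, the Wilson action (5) has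
a MINIMISER over `reg ∩ 𝔅_k(V)`: the tree's `IsBackground (avOfRecord F N K) reg k V U₀` («`Ū₀^k = V`, `U₀ ∈ reg`, `A(U₀) ≤ A(U)` for all `U ∈ reg`
with `Ū^k = V`»).  Compactness of the fibre (§1–§2) + continuity of the action (§1) + the extreme-value theorem.  Print obtains its minimiser
otherwise (Props 4–7, (142)). [cite: Balaban1985Variational, (5)–(6), (8) p.278 and Thm 1 p.279 («there exists a minimal orbit»)] -/
theorem exists_isBackground_of_isClosed (K k : ℕ) {α₀ : ℝ} (hα : 0 < α₀)
    (hα3 : (143 * (((((F.P K).d + 4 : ℕ) : ℝ)) ^ 2 / 4) ^ 2) * α₀ ≤ 1 / 3)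
    (hα2 : 2 * α₀ ≤ 2 * deltaSU (Fin N) / ((((F.P K).d + 4) * (F.P K).L : ℕ) : ℝ) ^ 2)
    {reg : Set (GaugeField (F.P K) 0 (SU N))} (hreg : IsClosed reg) (hsub : reg ⊆ bgReg F N K k α₀)
    {V : GaugeField (F.P K) k (SU N)} (hne : ∃ U ∈ reg, Averaging.iter (avOfRecord F N K) k U = V) :
    ∃ U₀ : GaugeField (F.P K) 0 (SU N), IsBackground (avOfRecord F N K) reg k V U₀ := by
  have hSc : IsClosed (reg ∩ Averaging.iter (avOfRecord F N K) k ⁻¹' {V}) := isClosed_inter_fibre K k hα hα3 hα2 hreg hsub V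
  have hSne : (reg ∩ Averaging.iter (avOfRecord F N K) k ⁻¹' {V}).Nonempty := by
    obtain ⟨U, hU, hUV⟩ := hne
    exact ⟨U, hU, hUV⟩
  obtain ⟨U₀, hU₀S, hmin⟩ := (isCompact_of_isClosed_cfg hSc).exists_isMinOn hSne continuous_wilsonAction4.continuousOn
  refine ⟨U₀, hU₀S.2, hU₀S.1, fun U hU hUV => ?_⟩
  exact (isMinOn_iff.1 hmin) U ⟨hU, hUV⟩

/-- **The direct method over the closure of ₈a's class `bgReg(e)`**, `e < α₀` admissible: a non-empty open-class fibre `bgReg(e) ∩ 𝔅_k(V)` gives a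
minimiser of (5) over `closure (bgReg e) ∩ 𝔅_k(V)`. [cite: Balaban1987RG1, (0.21), (1.1)–(1.2) pp.256, 260] -/
theorem exists_isBackground_closure_bgReg (K k : ℕ) {e α₀ : ℝ} (he : e < α₀) (hα : 0 < α₀)
    (hα3 : (143 * (((((F.P K).d + 4 : ℕ) : ℝ)) ^ 2 / 4) ^ 2) * α₀ ≤ 1 / 3)
    (hα2 : 2 * α₀ ≤ 2 * deltaSU (Fin N) / ((((F.P K).d + 4) * (F.P K).L : ℕ) : ℝ) ^ 2)
    {V : GaugeField (F.P K) k (SU N)} (hne : ∃ U ∈ bgReg F N K k e, Averaging.iter (avOfRecord F N K) k U = V) :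
    ∃ U₀ : GaugeField (F.P K) 0 (SU N), IsBackground (avOfRecord F N K) (closure (bgReg F N K k e)) k V U₀ :=
  exists_isBackground_of_isClosed K k hα hα3 hα2 isClosed_closure (closure_bgReg_subset_bgReg K k he)
    (hne.imp fun _ ⟨hU, hUV⟩ => ⟨subset_closure hU, hUV⟩)

/-- **The direct method over the closure of [B11] (2)'s class `𝔘_k(e)`** (`Ω_j = T`), `e < α₀` admissible: a non-empty open-class fibre
`𝔘_k(e) ∩ 𝔅_k(V)` gives a minimiser of (5) over `closure 𝔘_k(e) ∩ 𝔅_k(V)`. [cite: Balaban1985Variational, (2), (5)–(6), (8) p.278] -/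
theorem exists_isBackground_closure_inUkClassB11 (K k : ℕ) {e α₀ : ℝ} (he : e < α₀) (hα : 0 < α₀)
    (hα3 : (143 * (((((F.P K).d + 4 : ℕ) : ℝ)) ^ 2 / 4) ^ 2) * α₀ ≤ 1 / 3)
    (hα2 : 2 * α₀ ≤ 2 * deltaSU (Fin N) / ((((F.P K).d + 4) * (F.P K).L : ℕ) : ℝ) ^ 2)
    {V : GaugeField (F.P K) k (SU N)} (hne : ∃ U, InUkClassB11 F N K k e U ∧ Averaging.iter (avOfRecord F N K) k U = V) :
    ∃ U₀ : GaugeField (F.P K) 0 (SU N), IsBackground (avOfRecord F N K) (closure {U | InUkClassB11 F N K k e U}) k V U₀ :=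
  exists_isBackground_of_isClosed K k hα hα3 hα2 isClosed_closure (closure_inUkClassB11_subset_bgReg K k he)
    (hne.imp fun _ ⟨hU, hUV⟩ => ⟨subset_closure hU, hUV⟩)

/-- What a closed-class minimiser gives on the OPEN class for free: its action bounds the action of every open-class competitor over `V`.
[cite: Balaban1985Variational, (5)–(6) p.278 (bookkeeping)] -/
theorem wilsonAction4_le_of_isBackground_closure {K k : ℕ} {reg : Set (GaugeField (F.P K) 0 (SU N))} {V : GaugeField (F.P K) k (SU N)}
    {U₀ : GaugeField (F.P K) 0 (SU N)} (h : IsBackground (avOfRecord F N K) (closure reg) k V U₀)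
    {U : GaugeField (F.P K) 0 (SU N)} (hU : U ∈ reg) (hUV : Averaging.iter (avOfRecord F N K) k U = V) :
    wilsonAction4 U₀ ≤ wilsonAction4 U :=
  h.2.2 U (subset_closure hU) hUV

end DirectMethod

end Summit.QuantumFields.YangMills.BalabanUVNodes.N07DirectMethod

end
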